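import Summits.Ventures.AbcSig.Recipes.EisPackage

/-!
# Venture AbcSig — the NORM form of the trace sieve via characteristic polynomials ([BS04, Prop. 4.3] as printed)

HONEST FRAMING. Certificate checker of a COMPUTATION cell (`pub-abcsig`); no Diophantine statement, no claim on ABC or
any summit. The cell's ordinary sieve certificates (`Sieve/Certificate.lean`) work in the power basis `ℤ[θ]` of one
generator of the Hecke field; at primes `n` dividing the index of `ℤ[θ]` in the Hecke order EVERY eigenvalue entry
`d_ℓ c_ℓ = g_ℓ(θ)` has `n ∣ d_ℓ` and says nothing modulo `n`, so such `n` survive as artefacts (e.g. `43, 2011` at orbit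
`16928.69`, `13` at `16928.34`, `41, 116657` at `9248.50`). The printed method of [BS04, Prop. 4.3] needs no basis: if
`ρ^E_n` arises from `f` then `c_ℓ ≡ t (mod ν)` for some allowed trace `t`, hence `n ∣ N_{K/ℚ}(c_ℓ − t) = ±P_ℓ(t)`,
where `P_ℓ` is the characteristic polynomial of `c_ℓ` on the orbit. THIS FILE: the data shape `CPEntry = (ℓ, P_ℓ)`
(COMPUTED hypothesis `RefinesCP N o cp`: every newform matching the sieve data `o` has `P_ℓ(c_ℓ) = 0` for the listed
`ℓ` — backed by the engine level file exactly like `DataComplete` / `Refines`), the Boolean `cpKills cp A n N` ("some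
listed odd prime `ℓ ≠ n`, `ℓ ∤ N` has `n ∤ P_ℓ(t)` for every `t ∈ A ℓ`"), and THEOREM `excludesStd_of_cpKills`:
`BS04Package` + `RefinesCP` + `cpKills cp bs04Allowed n N` ⇒ `M.ExcludesStd N o n` (the shape the x-row templates take).

Reference: [BS04] Bennett–Skinner, Canad. J. Math. 56 (2004), Prop. 4.3 and p. 42.
-/

namespace Summit.Ventures.AbcSig

/-- One characteristic-polynomial entry of an orbit: at the prime `ell`, the Hecke eigenvalue `c_ell` of every newform of
the orbit is a root of the monic integer polynomial `P` (little-endian coefficients; intended: the characteristic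
polynomial of `T_ell` on the orbit). -/
structure CPEntry where
  /-- the prime `ℓ` -/
  ell : ℕ
  /-- a monic integer polynomial with `P(c_ℓ) = 0` -/
  P : List ℤ
  deriving DecidableEq, Repr

/-- **COMPUTED HYPOTHESIS** `M.RefinesCP N o cp`: every newform matching the sieve data `o` satisfies `P_ℓ(c_ℓ) = 0` for
every listed entry (same engine level file; the characteristic polynomials of the orbit). -/
def NewformModel.RefinesCP (M : NewformModel) (N : ℕ) (o : OrbitData) (cp : List CPEntry) : Prop :=
  ∀ f : M.Form N, M.Matches f o → ∀ e ∈ cp, evalL (M.eig N f e.ell) e.P = 0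

/-- **Norm-form kill** (Boolean): some entry at an odd prime `ℓ ≠ n`, `ℓ ∤ N`, has `P_ℓ(t) ≢ 0 (mod n)` for EVERY allowed
trace `t ∈ A ℓ`. -/
def cpKills (cp : List CPEntry) (A : ℕ → List ℤ) (n N : ℕ) : Bool :=
  cp.any fun e => decide e.ell.Prime && decide (e.ell ≠ 2) && decide (e.ell ≠ n) && decide (¬ e.ell ∣ N) &&
    (A e.ell).all fun t => hornerZ e.P t % (n : ℤ) != 0

/-- **[BS04, Prop. 4.3], norm form, in the kernel.** If `cpKills cp bs04Allowed n N` and the newforms matching `o`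
have the listed characteristic polynomials, then no standing datum with exponent `n` has its mod-`n` representation
arising from a newform of level `N` matching `o`. Proof: `BS04Package` gives `ψ` with `ψ(c_ℓ) = t`, `t` allowed; apply
`ψ` to `P_ℓ(c_ℓ) = 0` to get `P_ℓ(t) = 0` in a field of characteristic `n`, i.e. `n ∣ P_ℓ(t)`. -/
theorem NewformModel.excludesStd_of_cpKills (M : NewformModel) (hP : M.BS04Package) {N : ℕ} (o : OrbitData)
    (cp : List CPEntry) (hRef : M.RefinesCP N o cp) (n : ℕ) (hkill : cpKills cp bs04Allowed n N = true) :
    M.ExcludesStd N o n := by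
  intro S κ hS hn f hfo harises
  obtain ⟨hA, hB, hC, hsq, hprime, h7, hndvd, hfree, hsol, hab1, hab2, hcase⟩ := hS
  obtain ⟨-, hmod⟩ := hP S κ hA hB hC hsq hprime h7 hndvd hfree hsol hab1 hab2 hcase
  obtain ⟨k, hk, hchar, ψ, hψ⟩ := hmod N f harises
  simp only [cpKills, List.any_eq_true, Bool.and_eq_true, decide_eq_true_eq, List.all_eq_true] at hkill
  obtain ⟨e, he, ⟨⟨⟨⟨hep, he2⟩, hen⟩, heN⟩, hall⟩⟩ := hkill
  obtain ⟨t, ht, hψt⟩ := hψ e.ell hep he2 (by rw [hn]; exact hen) heN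
  have hroot : evalL (M.eig N f e.ell) e.P = 0 := hRef f hfo e he
  have h0 : ((hornerZ e.P t : ℤ) : k) = 0 := by
    rw [← map_evalL_eq_hornerZ ψ (M.eig N f e.ell) t hψt e.P, hroot, map_zero]
  have hchar' : CharP k n := hn ▸ hchar
  have hdvd : (n : ℤ) ∣ hornerZ e.P t := (CharP.intCast_eq_zero_iff k n _).mp h0
  have hne := hall t ht
  simp only [bne_iff_ne, ne_eq] at hne
  exact hne (Int.emod_eq_zero_of_dvd hdvd)

end Summit.Ventures.AbcSig
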